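import Summits.CriticalPhenomena.PercolationContinuityZ3.Theorems.Transplant.FKConnectivityAllQAntipodalTwoSumArith
import Summits.CriticalPhenomena.PercolationContinuityZ3.Theorems.Transplant.FKConnectivityAllQAntipodalOneSumClosure
import Summits.CriticalPhenomena.PercolationContinuityZ3.Theorems.Transplant.FKConnectivityAllQAntipodalMinorWeightUpc
import HarnessLib

/-!
# Connectivity correlation inequalities for `φ_{w,q}`, every `q > 0` — file 76a: **`C_∞⁺` ACROSS A 2-SEPARATION THAT SEPARATES THE
# TEST FUNCTIONS — UNCONDITIONAL, FOR EVERY `|S|`** (the product of two Theorem-U functionals)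

Support file (`--supports stmt-CriticalPhenomena-4575`), FK sub-lane `prim-bschramm-fk-2` (gen 34); builds on p205010 (kernel theorem,
internal audit signed; external expert review pending).  No definitions, no named facts, no sorries; standard axioms.

Let `E₁ ∥_{s,t} E₂` be a parallel gluing of two two-terminal series–parallel networks (vertex supports meeting inside `{s,t}`), with cells
`(M_i, C_i)`, `M_i, C_i ⊆ E_i`.  If the increasing test function `f` reads only edges of `E₁` and the increasing `g` only edges of `E₂`,
then for EVERY cut-off `J` the levelwise antipodal sum on the glued cell `(M₁ ∪ M₂, C₁ ∪ C₂)` is `≤ 0`: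
**`FK.levels_le_parallel_separated_nonpos`** — with no hypothesis on the size of the read sets and no induction hypothesis.
Proof (memo FROM-fk-2-g33-ODD-EVEN §3 (i), now kernel): by `FK.apExpC_parallel` the glued level is `ℓ₁ + ℓ₂ + [a₁∧a₂] + [b₁∧b₂] − 2|V|`;
`f̂` depends on `γ₁` only and is odd under `γ₁ ↦ M₁∖γ₁`, so antisymmetrising in `γ₁` turns the level indicator into the cross kernel
`−1{ℓ₁+ℓ₂ = m}·u₁u₂` (`FK.indDiff_kernel`), and the sum becomes `−½ Σ_{γ₁} u₁ f̂ · W(ℓ₁(γ₁))` with the NONNEGATIVE level weight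
`W(n) = Σ_{γ₂ : n+ℓ₂(γ₂) = m} u₂ ĝ` (Theorem U on block 2 with a one-shell weight, `FK.apUpcCLW_nonneg_of_isTTSP`); Theorem U on block 1 with
the weight `W` finishes.  Consequence (paper): Conjecture `C_∞⁺` holds for every pair `(f on E₁, g on E₂)` on every 2-connected series–parallel
host `E₁ ∥ E₂`, every cell, every level, every `|S|` — e.g. `K_{2,n}` with `S` a union of whole paths.
[cite: Grimmett2006, §1.4 eq. (1.20) (p. 15); §3.8 Thm. (3.90) (pp. 61–62); §3.9 (pp. 63–64)] [cite: Wagner2006, Thm. 5.8(d), §5.3]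
-/

noncomputable section

namespace Summit.CriticalPhenomena.PercolationContinuityZ3.Theorems

namespace FK

open SimpleGraph Literature.Probability.LatticeModels Literature.Probability.Percolation
open scoped Classical

variable {V : Type*} [Fintype V]

section Separated

variable {E₁ E₂ : Finset (Sym2 V)} {V₁ V₂ : Set V} {s t : V}

omit [Fintype V] in
/-- A function not reading the edges outside `R` is invariant under adjoining any set disjoint from `R`. [folklore] -/
theorem notRead_outside_union {f : Finset (Sym2 V) → ℝ} {R : Finset (Sym2 V)}
    (hf : ∀ e : Sym2 V, e ∉ R → ∀ A : Finset (Sym2 V), f (insert e A) = f A) :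
    ∀ U : Finset (Sym2 V), (∀ e ∈ U, e ∉ R) → ∀ B : Finset (Sym2 V), f (B ∪ U) = f B := by
  intro U
  induction U using Finset.induction_on with
  | empty => intro _ B; rw [Finset.union_empty]
  | @insert e U _ ih =>
    intro hU B
    rw [Finset.union_insert, hf e (hU e (Finset.mem_insert_self _ _)), ih (fun e' he' => hU e' (Finset.mem_insert_of_mem he')) B]

/-- **`C_∞⁺` across a separating 2-separation, every `|S|`, unconditional.**  See the module docstring.
[cite: Grimmett2006, §3.8 Thm. (3.90) (pp. 61–62); §3.9 (pp. 63–64)] [cite: Wagner2006, Thm. 5.8(d), §5.3] -/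
theorem levels_le_parallel_separated_nonpos (hd : Disjoint E₁ E₂) (hV₁ : ∀ e ∈ (↑E₁ : Set (Sym2 V)), ∀ z ∈ e, z ∈ V₁)
    (hV₂ : ∀ e ∈ (↑E₂ : Set (Sym2 V)), ∀ z ∈ e, z ∈ V₂) (hS : V₁ ∩ V₂ ⊆ {s, t}) (hst : s ≠ t)
    (hT₁ : IsTTSP E₁ s t) (hT₂ : IsTTSP E₂ s t)
    {M₁ M₂ C₁ C₂ : Finset (Sym2 V)} (hM₁ : M₁ ⊆ E₁) (hM₂ : M₂ ⊆ E₂) (hC₁ : C₁ ⊆ E₁) (hC₂ : C₂ ⊆ E₂)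
    {f g : Finset (Sym2 V) → ℝ}
    (hf : ∀ e : Sym2 V, e ∉ E₁ → ∀ A : Finset (Sym2 V), f (insert e A) = f A)
    (hfm : ∀ ⦃A B : Finset (Sym2 V)⦄, A ⊆ B → f A ≤ f B)
    (hg : ∀ e : Sym2 V, e ∉ E₂ → ∀ A : Finset (Sym2 V), g (insert e A) = g A)
    (hgm : ∀ ⦃A B : Finset (Sym2 V)⦄, A ⊆ B → g A ≤ g B) (J : ℕ) :
    ∑ γ ∈ (M₁ ∪ M₂).powerset with apExpC (M₁ ∪ M₂) (C₁ ∪ C₂) γ ≤ J,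
      (f (γ ∪ (C₁ ∪ C₂)) - f ((M₁ ∪ M₂) \ γ ∪ (C₁ ∪ C₂))) * (g (γ ∪ (C₁ ∪ C₂)) - g ((M₁ ∪ M₂) \ γ ∪ (C₁ ∪ C₂))) ≤ 0 := by
  have hdM : Disjoint M₁ M₂ := Finset.disjoint_of_subset_left hM₁ (Finset.disjoint_of_subset_right hM₂ hd)
  set N : ℕ := Fintype.card V with hNdef
  set m : ℕ := J + 2 * N with hm
  -- connection indicators of the two sides
  set a₁ : Finset (Sym2 V) → Bool := fun γ₁ => decide ((openGraph (↑(γ₁ ∪ C₁) : BondConfig V)).Reachable s t) with ha₁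
  set b₁ : Finset (Sym2 V) → Bool := fun γ₁ => decide ((openGraph (↑(M₁ \ γ₁ ∪ C₁) : BondConfig V)).Reachable s t) with hb₁
  set a₂ : Finset (Sym2 V) → Bool := fun γ₂ => decide ((openGraph (↑(γ₂ ∪ C₂) : BondConfig V)).Reachable s t) with ha₂
  set b₂ : Finset (Sym2 V) → Bool := fun γ₂ => decide ((openGraph (↑(M₂ \ γ₂ ∪ C₂) : BondConfig V)).Reachable s t) with hb₂
  -- the one-sided antipodal differences
  set F₁ : Finset (Sym2 V) → ℝ := fun γ₁ => f (γ₁ ∪ C₁) - f (M₁ \ γ₁ ∪ C₁) with hF₁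
  set G₂ : Finset (Sym2 V) → ℝ := fun γ₂ => g (γ₂ ∪ C₂) - g (M₂ \ γ₂ ∪ C₂) with hG₂
  set lv : Finset (Sym2 V) → Finset (Sym2 V) → ℕ := fun γ₁ γ₂ =>
    apExpC M₁ C₁ γ₁ + apExpC M₂ C₂ γ₂ + (if a₁ γ₁ = true ∧ a₂ γ₂ = true then 1 else 0) +
      (if b₁ γ₁ = true ∧ b₂ γ₂ = true then 1 else 0) with hlv
  set ind : Finset (Sym2 V) → Finset (Sym2 V) → ℝ := fun γ₁ γ₂ => if lv γ₁ γ₂ ≤ m then 1 else 0 with hind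
  -- `f` sees only block 1, `g` only block 2
  have out₂ : ∀ U : Finset (Sym2 V), U ⊆ E₂ → ∀ e ∈ U, e ∉ E₁ :=
    fun U hU e he heE => Finset.disjoint_left.1 hd heE (hU he)
  have out₁ : ∀ U : Finset (Sym2 V), U ⊆ E₁ → ∀ e ∈ U, e ∉ E₂ :=
    fun U hU e he heE => Finset.disjoint_left.1 hd (hU he) heE
  have f_eval : ∀ X Y : Finset (Sym2 V), X ⊆ E₁ → Y ⊆ E₂ → f (X ∪ Y) = f X :=
    fun X Y hX hY => notRead_outside_union hf Y (out₂ Y hY) X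
  have g_eval : ∀ X Y : Finset (Sym2 V), X ⊆ E₁ → Y ⊆ E₂ → g (X ∪ Y) = g Y := by
    intro X Y hX hY; rw [Finset.union_comm]; exact notRead_outside_union hg X (out₁ X hX) Y
  /- Step 1: the glued sum as a typed double sum of a product of one-sided differences. -/
  have step1 : ∑ γ ∈ (M₁ ∪ M₂).powerset with apExpC (M₁ ∪ M₂) (C₁ ∪ C₂) γ ≤ J,
      (f (γ ∪ (C₁ ∪ C₂)) - f ((M₁ ∪ M₂) \ γ ∪ (C₁ ∪ C₂))) * (g (γ ∪ (C₁ ∪ C₂)) - g ((M₁ ∪ M₂) \ γ ∪ (C₁ ∪ C₂))) =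
      ∑ γ₁ ∈ M₁.powerset, ∑ γ₂ ∈ M₂.powerset, ind γ₁ γ₂ * (F₁ γ₁ * G₂ γ₂) := by
    rw [Finset.sum_filter, sum_powerset_union_disj hdM]
    refine Finset.sum_congr rfl fun γ₁ hγ₁ => Finset.sum_congr rfl fun γ₂ hγ₂ => ?_
    have hγ₁' : γ₁ ⊆ M₁ := Finset.mem_powerset.1 hγ₁
    have hγ₂' : γ₂ ⊆ M₂ := Finset.mem_powerset.1 hγ₂
    have hlev := apExpC_parallel hd hV₁ hV₂ hS hst hM₁ hM₂ hC₁ hC₂ hγ₁' hγ₂'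
    have hiff : apExpC (M₁ ∪ M₂) (C₁ ∪ C₂) (γ₁ ∪ γ₂) ≤ J ↔ lv γ₁ γ₂ ≤ m := by
      simp only [hlv, ha₁, ha₂, hb₁, hb₂, decide_eq_true_eq, hm, hNdef]
      omega
    have hsd : (M₁ ∪ M₂) \ (γ₁ ∪ γ₂) ∪ (C₁ ∪ C₂) = (M₁ \ γ₁ ∪ C₁) ∪ (M₂ \ γ₂ ∪ C₂) := by
      rw [union_sdiff_union hdM hγ₁' hγ₂', Finset.union_union_union_comm]
    have hun : γ₁ ∪ γ₂ ∪ (C₁ ∪ C₂) = (γ₁ ∪ C₁) ∪ (γ₂ ∪ C₂) := Finset.union_union_union_comm _ _ _ _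
    have e1 : f (γ₁ ∪ γ₂ ∪ (C₁ ∪ C₂)) = f (γ₁ ∪ C₁) := by
      rw [hun]; exact f_eval _ _ (Finset.union_subset (hγ₁'.trans hM₁) hC₁) (Finset.union_subset (hγ₂'.trans hM₂) hC₂)
    have e2 : f ((M₁ ∪ M₂) \ (γ₁ ∪ γ₂) ∪ (C₁ ∪ C₂)) = f (M₁ \ γ₁ ∪ C₁) := by
      rw [hsd]
      exact f_eval _ _ (Finset.union_subset (Finset.sdiff_subset.trans hM₁) hC₁)
        (Finset.union_subset (Finset.sdiff_subset.trans hM₂) hC₂)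
    have e3 : g (γ₁ ∪ γ₂ ∪ (C₁ ∪ C₂)) = g (γ₂ ∪ C₂) := by
      rw [hun]; exact g_eval _ _ (Finset.union_subset (hγ₁'.trans hM₁) hC₁) (Finset.union_subset (hγ₂'.trans hM₂) hC₂)
    have e4 : g ((M₁ ∪ M₂) \ (γ₁ ∪ γ₂) ∪ (C₁ ∪ C₂)) = g (M₂ \ γ₂ ∪ C₂) := by
      rw [hsd]
      exact g_eval _ _ (Finset.union_subset (Finset.sdiff_subset.trans hM₁) hC₁)
        (Finset.union_subset (Finset.sdiff_subset.trans hM₂) hC₂)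
    rw [e1, e2, e3, e4]
    simp only [hind, hF₁, hG₂]
    by_cases hle : apExpC (M₁ ∪ M₂) (C₁ ∪ C₂) (γ₁ ∪ γ₂) ≤ J
    · rw [if_pos hle, if_pos (hiff.1 hle), one_mul]
    · rw [if_neg hle, if_neg (fun h => hle (hiff.2 h)), zero_mul]
  rw [step1]
  /- Symmetries. -/
  have F₁_flip : ∀ γ₁ : Finset (Sym2 V), γ₁ ⊆ M₁ → F₁ (M₁ \ γ₁) = -F₁ γ₁ := by
    intro γ₁ hγ₁; simp only [hF₁, Finset.sdiff_sdiff_eq_self hγ₁]; ring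
  have a₁_flip : ∀ γ₁ : Finset (Sym2 V), γ₁ ⊆ M₁ → a₁ (M₁ \ γ₁) = b₁ γ₁ := by
    intro γ₁ hγ₁; simp only [ha₁, hb₁]
  have b₁_flip : ∀ γ₁ : Finset (Sym2 V), γ₁ ⊆ M₁ → b₁ (M₁ \ γ₁) = a₁ γ₁ := by
    intro γ₁ hγ₁; simp only [ha₁, hb₁, Finset.sdiff_sdiff_eq_self hγ₁]
  have ℓ₁_flip : ∀ γ₁ : Finset (Sym2 V), γ₁ ⊆ M₁ → apExpC M₁ C₁ (M₁ \ γ₁) = apExpC M₁ C₁ γ₁ :=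
    fun γ₁ hγ₁ => apExpC_sdiff M₁ C₁ hγ₁
  /- Step 2: antisymmetrise in `γ₁`; the level indicator becomes the cross kernel. -/
  set u₁ : Finset (Sym2 V) → ℝ := fun γ₁ => (if a₁ γ₁ = true then (1 : ℝ) else 0) - (if b₁ γ₁ = true then 1 else 0) with hu₁
  set u₂ : Finset (Sym2 V) → ℝ := fun γ₂ => (if a₂ γ₂ = true then (1 : ℝ) else 0) - (if b₂ γ₂ = true then 1 else 0) with hu₂
  have hsym : ∑ γ₁ ∈ M₁.powerset, ∑ γ₂ ∈ M₂.powerset, ind γ₁ γ₂ * (F₁ γ₁ * G₂ γ₂) =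
      (∑ γ₁ ∈ M₁.powerset, ∑ γ₂ ∈ M₂.powerset, (ind γ₁ γ₂ - ind (M₁ \ γ₁) γ₂) * (F₁ γ₁ * G₂ γ₂)) / 2 := by
    have h2 := sum_powerset_flip M₁ (fun γ₁ => ∑ γ₂ ∈ M₂.powerset, ind γ₁ γ₂ * (F₁ γ₁ * G₂ γ₂))
    have h3 : ∑ γ₁ ∈ M₁.powerset, ∑ γ₂ ∈ M₂.powerset, ind (M₁ \ γ₁) γ₂ * (F₁ (M₁ \ γ₁) * G₂ γ₂) =
        ∑ γ₁ ∈ M₁.powerset, ∑ γ₂ ∈ M₂.powerset, -(ind (M₁ \ γ₁) γ₂ * (F₁ γ₁ * G₂ γ₂)) := by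
      refine Finset.sum_congr rfl fun γ₁ hγ₁ => Finset.sum_congr rfl fun γ₂ _ => ?_
      rw [F₁_flip γ₁ (Finset.mem_powerset.1 hγ₁)]; ring
    rw [h3] at h2
    have h4 : ∑ γ₁ ∈ M₁.powerset, ∑ γ₂ ∈ M₂.powerset, (ind γ₁ γ₂ - ind (M₁ \ γ₁) γ₂) * (F₁ γ₁ * G₂ γ₂) =
        (∑ γ₁ ∈ M₁.powerset, ∑ γ₂ ∈ M₂.powerset, ind γ₁ γ₂ * (F₁ γ₁ * G₂ γ₂)) +
          ∑ γ₁ ∈ M₁.powerset, ∑ γ₂ ∈ M₂.powerset, -(ind (M₁ \ γ₁) γ₂ * (F₁ γ₁ * G₂ γ₂)) := by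
      rw [← Finset.sum_add_distrib]
      refine Finset.sum_congr rfl fun γ₁ _ => ?_
      rw [← Finset.sum_add_distrib]
      exact Finset.sum_congr rfl fun γ₂ _ => by ring
    rw [h4, ← h2]; ring
  rw [hsym]
  have hker : ∀ γ₁ γ₂ : Finset (Sym2 V), γ₁ ⊆ M₁ →
      ind γ₁ γ₂ - ind (M₁ \ γ₁) γ₂ = -(if apExpC M₁ C₁ γ₁ + apExpC M₂ C₂ γ₂ = m then u₁ γ₁ * u₂ γ₂ else 0) := by
    intro γ₁ γ₂ hγ₁
    simp only [hind, hlv, hu₁, hu₂, a₁_flip γ₁ hγ₁, b₁_flip γ₁ hγ₁, ℓ₁_flip γ₁ hγ₁]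
    exact indDiff_kernel _ _ _ (a₁ γ₁) (b₁ γ₁) (a₂ γ₂) (b₂ γ₂)
  have step2 : ∑ γ₁ ∈ M₁.powerset, ∑ γ₂ ∈ M₂.powerset, (ind γ₁ γ₂ - ind (M₁ \ γ₁) γ₂) * (F₁ γ₁ * G₂ γ₂) =
      -∑ γ₁ ∈ M₁.powerset, u₁ γ₁ * F₁ γ₁ *
        ∑ γ₂ ∈ M₂.powerset, (if apExpC M₁ C₁ γ₁ + apExpC M₂ C₂ γ₂ = m then (1 : ℝ) else 0) * (u₂ γ₂ * G₂ γ₂) := by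
    rw [← Finset.sum_neg_distrib]
    refine Finset.sum_congr rfl fun γ₁ hγ₁ => ?_
    rw [Finset.mul_sum, ← Finset.sum_neg_distrib]
    refine Finset.sum_congr rfl fun γ₂ _ => ?_
    rw [hker γ₁ γ₂ (Finset.mem_powerset.1 hγ₁)]
    split_ifs <;> ring
  rw [step2]
  /- Step 3: the inner sum is Theorem U on block 2 with a one-shell weight, hence a nonnegative level weight for block 1. -/
  set W : ℕ → ℝ := fun n =>
    apUpcCLW (fun k => if n + k = m then (1 : ℝ) else 0) M₂ C₂ s t G₂ with hW
  have hG₂mono : ∀ ⦃A B : Finset (Sym2 V)⦄, A ⊆ B → B ⊆ M₂ → G₂ A ≤ G₂ B := by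
    intro A B hAB _
    simp only [hG₂]
    have h1 : g (A ∪ C₂) ≤ g (B ∪ C₂) := hgm (Finset.union_subset_union hAB le_rfl)
    have h2 : g (M₂ \ B ∪ C₂) ≤ g (M₂ \ A ∪ C₂) :=
      hgm (Finset.union_subset_union (Finset.sdiff_subset_sdiff le_rfl hAB) le_rfl)
    linarith
  have hF₁mono : ∀ ⦃A B : Finset (Sym2 V)⦄, A ⊆ B → B ⊆ M₁ → F₁ A ≤ F₁ B := by
    intro A B hAB _
    simp only [hF₁]
    have h1 : f (A ∪ C₁) ≤ f (B ∪ C₁) := hfm (Finset.union_subset_union hAB le_rfl)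
    have h2 : f (M₁ \ B ∪ C₁) ≤ f (M₁ \ A ∪ C₁) :=
      hfm (Finset.union_subset_union (Finset.sdiff_subset_sdiff le_rfl hAB) le_rfl)
    linarith
  have hWnn : ∀ n, 0 ≤ W n := fun n =>
    apUpcCLW_nonneg_of_isTTSP hT₂ M₂ C₂ hM₂ hC₂ _ (fun k => by positivity) G₂ hG₂mono
  have inner : ∀ γ₁ : Finset (Sym2 V),
      ∑ γ₂ ∈ M₂.powerset, (if apExpC M₁ C₁ γ₁ + apExpC M₂ C₂ γ₂ = m then (1 : ℝ) else 0) * (u₂ γ₂ * G₂ γ₂) =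
        W (apExpC M₁ C₁ γ₁) := by
    intro γ₁
    simp only [hW, apUpcCLW, apConn, hu₂, ha₂, hb₂, decide_eq_true_eq]
    refine Finset.sum_congr rfl fun γ₂ _ => ?_
    split_ifs <;> ring
  simp_rw [inner]
  have outer : ∑ γ₁ ∈ M₁.powerset, u₁ γ₁ * F₁ γ₁ * W (apExpC M₁ C₁ γ₁) = apUpcCLW W M₁ C₁ s t F₁ := by
    simp only [apUpcCLW, apConn, hu₁, ha₁, hb₁, decide_eq_true_eq]
    refine Finset.sum_congr rfl fun γ₁ _ => ?_
    split_ifs <;> ring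
  rw [outer]
  have key := apUpcCLW_nonneg_of_isTTSP hT₁ M₁ C₁ hM₁ hC₁ W hWnn F₁ hF₁mono
  refine div_nonpos_of_nonpos_of_nonneg ?_ (by norm_num)
  linarith

end Separated

end FK

end Summit.CriticalPhenomena.PercolationContinuityZ3.Theorems

end
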